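import Summits.QuantumFields.YangMills.Theorems.LuscherReductionTwistedTraceScalingBOCoreComplement
import Summits.QuantumFields.YangMills.Theorems.LuscherReductionTwistedTraceScalingGaugeActionCovariant
import Summits.QuantumFields.YangMills.Theorems.LuscherReductionTwistedTraceScalingBTWindow
import HarnessLib

/-!
# (C1c'-η') THE SHARP SLOW-MEAN FACT ON THE LAPLACE CORE: `‖q(slowMean(U_w)_k) − 1‖ ≤ 2‖p‖ + 6ρ''`, `ρ'' = 40(4r² + 2r‖p‖) + 3r` — the slow displacement of the representative plus a
# SECOND-ORDER gauge term, instead of `5 ×` the fat LINK radius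
# (lane A of S-BASE, crux `TwistedTraceScaling` stmt-QuantumFields-20203, C4-CORE, the (OD) pen; repair of the window floor of `…BOLocalisedAvgChartLower`, HANDOFF-g18 "DESIGN POINTS")

`…BOSliceCoreIndicators.slice_core_indicator_facts` bounds the slow mean of the Laplace-core orbit points `U_w = (tubePt p)^{basedExt(gno∘w)}` by `5ρ_f` (`ρ_f` the fat LINK radius
`MKβ^{-s}`).  Feeding that into the window floor `χ_lo ≤ χ₀` forces the smearing window `δu ≥ 5MKβ^{-s}`, while `supp boFun χ₀ Ω ⊆ supp recordChi` forces `δu ≲ Kβ^{-s}/L³` — incompatible.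
The true slow mean is much closer to `1`: `(tubePt p)^{P∘ξ} = covRel u ξ p.1 · constLift u` (`…GaugeActionCovariant.gaugeTransform_orthoTube_eq`), the polar mean of `covRel` moves only at
SECOND order (`polarMean_parts_small_of_lin`; the non-zero mean of a BASED `ξ` is absorbed into the linear prediction, costing `3r`), and `polarMean(V·constLift u) = polarMean(V)·u_k`:
★★ `slowMean_slice_core_sharp` — for `‖p‖ ≤ 1/40`, `‖w‖ ≤ r ≤ 1/40`: `‖q(slowMean(U_w)(0,k)) − 1‖ ≤ 2‖p‖ + 6(40(4r² + 2r‖p‖) + 3r)` for every `k`, and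
`S₁(slowMean U_w) ≤ 12(2‖p‖ + 6(40(4r² + 2r‖p‖) + 3r))⁴`.  With `‖p‖ ≤ (4+48K)ρ = O(KLβ^{-1/2}ℓ²)` and `r = β^{-1}ℓ³` this is `O(KLβ^{-1/2}ℓ²) ≪ β^{-s'}/L³` for every `s' < 1/2`:
the smearing window can be taken INSIDE the orbit cut-off of an auxiliary fat tube.
HONEST FRAMING: bookkeeping for a stub of a child of the CONDITIONAL route R2b1; (C1) packaging/rates, (C4), (C5), (B-ST) OPEN; C4-CORE OPEN; not infinite volume, not a gap, not Clay.
-/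

set_option autoImplicit false

noncomputable section

open MeasureTheory Real
open scoped BigOperators Matrix Quaternion
open Literature.MathematicalPhysics.QuantumFieldTheory
open Literature.MathematicalPhysics.QuantumLattice

namespace Summit.QuantumFields.YangMills.Theorems.FemtoTransferGap.TwoLattice.ConstTube

open Summit.QuantumFields.YangMills.Theorems.FemtoTransferGap
open Summit.QuantumFields.YangMills.Theorems.FemtoTransferGap.TwoLattice
open Summit.QuantumFields.YangMills.Theorems.FemtoTransferGap.TwoLattice.Avg
open Summit.QuantumFields.YangMills.Theorems.FemtoTransferGap.TwoLattice.GnChart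
open Literature.MathematicalPhysics.QuantumFieldTheory.Balaban1983to89.T4CubeChartGnomonic (gnoPoint)

variable {L : ℕ} [NeZero L]

/-! ## §1 Quaternion bookkeeping -/

omit [NeZero L] in
/-- From `‖A⃗‖∞ ≤ 2ρ`, `0 ≤ 1 − A₀ ≤ 4ρ`: `‖q(A) − 1‖ ≤ 6ρ`. [folklore] -/
theorem norm_su2Quat_sub_one_le_of_parts {A : SU2} {ρ : ℝ} (hv : ‖vecPart A‖ ≤ 2 * ρ) (hs0 : 0 ≤ 1 - scalarPart A) (hs : 1 - scalarPart A ≤ 4 * ρ) :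
    ‖su2Quat A - 1‖ ≤ 6 * ρ := by
  have hρ0 : 0 ≤ ρ := by linarith [norm_nonneg (vecPart A)]
  have hva : ∀ a, vecPart A a ^ 2 ≤ (2 * ρ) ^ 2 := fun a => by
    have h1 := norm_le_pi_norm (vecPart A) a
    rw [Real.norm_eq_abs] at h1
    rw [← sq_abs]; exact pow_le_pow_left₀ (abs_nonneg _) (h1.trans hv) 2
  have hsq : ‖su2Quat A - 1‖ ^ 2 ≤ (6 * ρ) ^ 2 := by
    rw [norm_su2Quat_sub_one_sq, Fin.sum_univ_three]
    nlinarith [hva 0, hva 1, hva 2]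
  exact (pow_le_pow_iff_left₀ (norm_nonneg _) (by positivity) two_ne_zero).1 hsq

/-! ## §2 ★★ The sharp slow mean on the Laplace core -/

/-- ★★ **THE SHARP SLOW-MEAN FACT.**  For a base point `p` with `‖p‖ ≤ 1/40` and a flat based parameter `‖w‖ ≤ r ≤ 1/40`, the orbit point `U_w = (tubePt p)^{basedExt(gno∘w)}` has, for every
direction `k`, `‖q(slowMean U_w (0,k)) − 1‖ ≤ 2‖p‖ + 6(40(4r² + 2r‖p‖) + 3r)` and `S₁(slowMean U_w) ≤ 12(2‖p‖ + 6(40(4r² + 2r‖p‖) + 3r))⁴`. [folklore] -/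
theorem slowMean_slice_core_sharp (p : balancedSubmodule L × (Fin 3 → Fin 3 → ℝ)) (hp40 : ‖p‖ ≤ 1 / 40)
    {r : ℝ} (hr40 : r ≤ 1 / 40) {w : NzSite L → Fin 3 → ℝ} (hw : ‖w‖ ≤ r) :
    (∀ k : Fin 3, ‖su2Quat (slowMean L (gaugeTransform (basedExt L fun y => gnoPoint (w y)) (tubePt L p)) (0, k)) - 1‖ ≤
        2 * ‖p‖ + 6 * (40 * (4 * r ^ 2 + 2 * r * ‖p‖) + 3 * r)) ∧
      wilsonAction su2Rep (slowMean L (gaugeTransform (basedExt L fun y => gnoPoint (w y)) (tubePt L p))) ≤ 12 * (2 * ‖p‖ + 6 * (40 * (4 * r ^ 2 + 2 * r * ‖p‖) + 3 * r)) ^ 4 := by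
  have hr0 : 0 ≤ r := (norm_nonneg _).trans hw
  have hp0 : 0 ≤ ‖p‖ := norm_nonneg _
  -- the based parameter and the decomposition `U_w = covRel u ξ p.1 · constLift u`
  set ξ : Site 3 L → Fin 3 → ℝ := (gnoParam L w : Site 3 L → Fin 3 → ℝ) with hξ
  set u : GaugeConfig 3 1 SU2 := fun e₁ => chartSU2 (p.2 e₁.2) with hu
  set wv : Edge 3 L → Fin 3 → ℝ := (p.1 : Edge 3 L → Fin 3 → ℝ) with hwv
  have hG : ∀ x, ‖ξ x‖ ≤ r := fun x => (norm_le_pi_norm _ x).trans ((norm_gnoParam_le L w).trans hw)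
  have hω : ∀ e, ‖wv e‖ ≤ ‖p‖ := fun e => (norm_le_pi_norm _ e).trans ((by rw [hwv, ← Submodule.coe_norm]; exact norm_fst_le p))
  have hG1 : r ≤ 1 / 40 := hr40
  have hω1 : ‖p‖ ≤ 1 / 20 := hp40.trans (by norm_num)
  have hξ1 : ∀ x, ∑ a, ξ x a ^ 2 ≤ 1 := fun x => by
    have h3 := sum_sq_le_three_norm_sq (ξ x)
    have hx : ‖ξ x‖ ≤ 1 / 40 := (hG x).trans hG1
    nlinarith [norm_nonneg (ξ x)]
  have hdec : gaugeTransform (basedExt L fun y => gnoPoint (w y)) (tubePt L p) = covRel L u ξ wv * constLift L u := by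
    rw [basedExt_gno_eq]
    exact gaugeTransform_orthoTube_eq L u ξ wv hξ1
  -- the linear prediction with its mean removed
  set N : ℝ := (Fintype.card (Site 3 L) : ℝ) with hN
  have hNpos : 0 < N := by rw [hN]; exact_mod_cast Fintype.card_pos
  have hbal : ∀ (k : Fin 3) (a : Fin 3), ∑ x : Site 3 L, wv (x, k) a = 0 := p.1.2
  set m : Fin 3 → Fin 3 → ℝ := fun k => N⁻¹ • ∑ x : Site 3 L, (wv (x, k) + ξ x - (adRot (u (0, k))).mulVec (ξ (x.shift k))) with hm
  have hm_le : ∀ k, ‖m k‖ ≤ 3 * r := fun k => by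
    have hw0 : ∑ x : Site 3 L, wv (x, k) = 0 := by funext a; rw [Finset.sum_apply, Pi.zero_apply]; exact hbal k a
    have hsum : ∑ x : Site 3 L, (wv (x, k) + ξ x - (adRot (u (0, k))).mulVec (ξ (x.shift k))) =
        ∑ x : Site 3 L, ξ x - ∑ x : Site 3 L, (adRot (u (0, k))).mulVec (ξ (x.shift k)) := by
      rw [Finset.sum_sub_distrib, Finset.sum_add_distrib, hw0, zero_add]
    have h1 : ‖∑ x : Site 3 L, ξ x‖ ≤ N * r := by
      calc ‖∑ x : Site 3 L, ξ x‖ ≤ ∑ x : Site 3 L, ‖ξ x‖ := norm_sum_le _ _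
        _ ≤ ∑ _x : Site 3 L, r := Finset.sum_le_sum fun x _ => hG x
        _ = N * r := by rw [Finset.sum_const, Finset.card_univ, nsmul_eq_mul, hN]
    have h2 : ‖∑ x : Site 3 L, (adRot (u (0, k))).mulVec (ξ (x.shift k))‖ ≤ N * (2 * r) := by
      calc _ ≤ ∑ x : Site 3 L, ‖(adRot (u (0, k))).mulVec (ξ (x.shift k))‖ := norm_sum_le _ _
        _ ≤ ∑ _x : Site 3 L, 2 * r := Finset.sum_le_sum fun x _ => (norm_adRot_mulVec_le _ _).trans (by linarith [hG (x.shift k)])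
        _ = N * (2 * r) := by rw [Finset.sum_const, Finset.card_univ, nsmul_eq_mul, hN]
    rw [hm]; dsimp only
    rw [hsum, norm_smul, Real.norm_eq_abs, abs_of_pos (inv_pos.2 hNpos)]
    calc N⁻¹ * ‖∑ x : Site 3 L, ξ x - ∑ x : Site 3 L, (adRot (u (0, k))).mulVec (ξ (x.shift k))‖ ≤ N⁻¹ * (N * r + N * (2 * r)) :=
          mul_le_mul_of_nonneg_left ((norm_sub_le _ _).trans (add_le_add h1 h2)) (inv_pos.2 hNpos).le
      _ = 3 * r := by field_simp; ring
  set lin : Edge 3 L → Fin 3 → ℝ := fun e => (wv e + ξ e.1 - (adRot (u (0, e.2))).mulVec (ξ (e.1.shift e.2))) - m e.2 with hlin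
  set ρ'' : ℝ := 40 * (4 * r ^ 2 + 2 * r * ‖p‖) + 3 * r with hρ''
  have hlin_le : ∀ e, ‖vecPart (covRel L u ξ wv e) - lin e‖ ≤ ρ'' := fun e => by
    have h := norm_vecPart_covRel_sub_linear_le (u := u) hG hω hG1 hω1 e
    rw [hlin]; dsimp only
    rw [show vecPart (covRel L u ξ wv e) - (wv e + ξ e.1 - (adRot (u (0, e.2))).mulVec (ξ (e.1.shift e.2)) - m e.2) =
      (vecPart (covRel L u ξ wv e) - (wv e + ξ e.1 - (adRot (u (0, e.2))).mulVec (ξ (e.1.shift e.2)))) + m e.2 by abel]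
    exact (norm_add_le _ _).trans (by rw [hρ'']; linarith [hm_le e.2])
  have hhalf : ∀ e, 1 / 2 ≤ scalarPart (covRel L u ξ wv e) := fun e => half_le_scalarPart_covRel hG hω hG1 hω1 e
  have hsum0 : ∀ k : Fin 3, ∑ x : Site 3 L, lin (x, k) = 0 := fun k => by
    rw [hlin]; dsimp only
    rw [Finset.sum_sub_distrib, Finset.sum_const, Finset.card_univ, hm]; dsimp only
    rw [← Nat.cast_smul_eq_nsmul ℝ, smul_smul, ← hN, mul_inv_cancel₀ hNpos.ne', one_smul, sub_self]
  -- the polar mean of `covRel` is second-order close to `1`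
  have hpol : ∀ k : Fin 3, ‖su2Quat (polarMean L k (covRel L u ξ wv)) - 1‖ ≤ 6 * ρ'' := fun k => by
    obtain ⟨hv, hs0, hs⟩ := polarMean_parts_small_of_lin (V := covRel L u ξ wv) hlin_le hhalf hsum0 k
    exact norm_su2Quat_sub_one_le_of_parts hv hs0 hs
  have hdir : ∀ k : Fin 3, dirQuat L k (covRel L u ξ wv) ≠ 0 := fun k => dirQuat_covRel_ne_zero hG hω hG1 hω1 k
  -- the slow factor `u_k = chartSU2 (p.2 k)`
  have huk : ∀ k : Fin 3, ‖su2Quat (u (0, k)) - 1‖ ≤ 2 * ‖p‖ := fun k => by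
    have h1 : ‖p.2 k‖ ≤ ‖p‖ := (norm_le_pi_norm _ k).trans (norm_snd_le p)
    exact norm_su2Quat_chartSU2_sub_one_le h1 (hp40.trans (by norm_num))
  have hk : ∀ k : Fin 3, ‖su2Quat (slowMean L (gaugeTransform (basedExt L fun y => gnoPoint (w y)) (tubePt L p)) (0, k)) - 1‖ ≤ 2 * ‖p‖ + 6 * ρ'' := fun k => by
    rw [hdec]
    show ‖su2Quat (polarMean L k (covRel L u ξ wv * constLift L u)) - 1‖ ≤ _
    rw [polarMean_mul_constLift L _ u (hdir k)]
    -- `‖q(AB) − 1‖ ≤ ‖q(A) − 1‖ + ‖q(B) − 1‖` (cf. `…RateTube.norm_su2Quat_mul_sub_one_le`)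
    have hprod : ∀ A B : SU2, ‖su2Quat (A * B) - 1‖ ≤ ‖su2Quat A - 1‖ + ‖su2Quat B - 1‖ := fun A B => by
      have h : su2Quat (A * B) - 1 = (su2Quat A - 1) * su2Quat B + (su2Quat B - 1) := by rw [su2Quat_mul, sub_mul, one_mul]; abel
      rw [h]
      calc _ ≤ ‖(su2Quat A - 1) * su2Quat B‖ + ‖su2Quat B - 1‖ := norm_add_le _ _
        _ = ‖su2Quat A - 1‖ + ‖su2Quat B - 1‖ := by rw [norm_mul, norm_su2Quat, mul_one]
    have := hprod (polarMean L k (covRel L u ξ wv)) (u (0, k))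
    linarith [hpol k, huk k]
  refine ⟨fun k => by rw [hρ''] at hk; exact hk k, ?_⟩
  refine wilsonAction_one_site_le _ fun e => ?_
  have h := hk e.2
  rw [hρ''] at h
  exact h

end Summit.QuantumFields.YangMills.Theorems.FemtoTransferGap.TwoLattice.ConstTube

end
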